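import Mathlib
import Summits.ABC.ABC.Statement
import Summits.ABC.ABC.Theorems.SoloInformedRNShape

/-!
# The Ramanujan–Nagell face re-typed: per-base RN-shape is a theorem in print; what `abc` adds is
# uniformity in the base — the diagonal statements (RN-diag) and (RN-diag-fin) (solo-ABC-informed, s16)

Correction of the s15 reading recorded in `SoloInformedRNShape`. For a FIXED non-square base `q` the
RN-shape `x² + D = qⁿ ⟹ qⁿ ≤ K_q · D^{M_q}` is a THEOREM for every `q`: M. A. Bennett, Y. Bugeaud,
*Effective results for restricted rational approximation to quadratic irrationals*, Acta Arith. 155 (2012)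
259–269, Theorem 1.2 (p. 261): `‖bⁿξ‖ > c(ξ,b)·b^{−(1−τ(ξ,P))n}` with `τ` effective (Schinzel's argument in
`ℚ(√q)` with the Bugeaud–Laurent bound for two `p`-adic logarithms, Theorem 2.1 p. 263); with `ξ = √q`,
`b = q` this is `qⁿ ≤ K_q·D^{2/τ}`. For `q = 5` it is even explicit by the hypergeometric method:
M. Bauer, M. A. Bennett, Ramanujan J. 6 (2002) 209–270, Corollary 1.7 (p. 216) with `λ₂(5) = 1.36`
(table (1.18), anchor `11² + 4 = 5³`, table (9.1)): `x² + D = 5ⁿ`, `D ≠ 0` ⟹ `n < 3.125·log|D|/log 5`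
unless `(n, D) ∈ {(3, 4), (5, −11)}` (`soloInformed_bauerBennett_base5`). So "(RN₅) open" (s15) was wrong;
`7` and `11` are outside the Padé tables of 2002 (ibid. p. 216: "this is apparently the case, for instance,
when y = 7") but inside Theorem 1.2 of 2012.

What is NOT in print, and what `abc` gives with one constant (`soloInformed_rnShape_of_abc`: `qⁿ < K·D⁶·q⁶`
for all bases at once), is UNIFORMITY IN THE BASE — Bennett–Bugeaud's own open problem (ibid. p. 262:
"Prove that for every quadratic number ξ there exists an effectively computable positive number τ(ξ) such
that v_e^b(ξ) ≤ 1 − τ(ξ) for every b ≥ 2"), here along the diagonal `(ξ, b) = (√q, q)`. Its thinnest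
forms are typed below: (RN-diag) `x² + D = qⁿ`, `0 < D < q`, `gcd(D, x) = 1` ⟹ `n ≤ N₀` with ONE `N₀`
(`soloInformed_rnDiag_of_abc`, from the RN-shape at `ε = 1/2`), and (RN-diag-fin): only finitely many
`(y, n ≥ 5, x)` (`soloInformed_rnDiagFinite_of_abc`, from `abc` at `ε = 1/10`: `y^{9n−44} < C²⁰`).
Effective knowledge on (RN-diag) is `n ≲ √q·polylog` by either of two routes, each losing the class-number
datum of an auxiliary quadratic field: `n = h′·t`, `t` absolutely bounded, `h′ ≤ h(−4D)` in `ℚ(√−D)`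
(primitive divisors), or `n·log q ≪ max(1, R_q/log q)·(log D + R_q + log q)` in `ℚ(√q)` (Theorem 2.1 at the
ramified prime `(√q)`, where the fundamental unit is automatically a 4th root of unity mod `(√q)`, so the
residue-torsion factor is absent and the whole loss is the regulator `R_q`). The seat's exact enumeration
(work/s16/rndiag.py, `y ≤ 10⁷`, odd `n ≥ 5`, `yⁿ ≤ 10¹⁰⁰`; even `n` is impossible since
`y^{2j} − x² = (y^j − x)(y^j + x) > y`) finds exactly four solutions of `0 < |yⁿ − x²| < y`, all with
`n = 5`, `D > 0`, `y` composite (`soloInformed_rnDiag_solutions`); two of them are Bauer–Bennett's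
exceptional triples `(55, 5, 19)`, `(76, 5, 60)`.
[cite: BennettBugeaud2012, Thm 1.2 p.261, Thm 2.1 p.263, open problem p.262]
[cite: BauerBennett2002, Cor 1.4 p.213, Cor 1.7 p.216]
-/

namespace Summit.ABC.ABC.Theorems

open Literature.NumberTheory.DiophantineGeometry UniqueFactorizationMonoid

/-- **(RN-diag) from abc.** One `N₀` such that `x² + D = qⁿ` with `0 < D < q`, `x ≥ 1`, `gcd(D, x) = 1`
forces `n ≤ N₀`, for every base `q` at once (from `qⁿ < K·D⁶·q⁶ < K·q¹²`). Unconditionally only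
`n ≲ √q·polylog` is known (two routes, see the module docstring); for each FIXED `q` finiteness of `n` is
Bennett–Bugeaud 2012, Thm 1.2. [folklore] -/
theorem soloInformed_rnDiag_of_abc (habc : _root_.ABC) :
    ∃ N₀ : ℕ, ∀ q x D n : ℕ, 0 < x → 0 < D → Nat.Coprime D x → x ^ 2 + D = q ^ n → D < q →
      n ≤ N₀ := by
  obtain ⟨K, hK, hK'⟩ := soloInformed_rnShape_of_abc habc
  obtain ⟨N₁, hN₁⟩ := exists_nat_gt K
  refine ⟨N₁ + 12, fun q x D n hx hD hcop h hDq => ?_⟩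
  have hq : 0 < q := by omega
  by_contra hn'
  have hn : N₁ + 12 < n := by omega
  have hlt := hK' q x D n hq hx hD hcop h
  have hq2 : (2 : ℝ) ≤ q := by exact_mod_cast (show 2 ≤ q by omega)
  have hq0 : (0 : ℝ) < q := by linarith
  have hDq' : (D : ℝ) < q := by exact_mod_cast hDq
  have hD0 : (0 : ℝ) < D := by exact_mod_cast hD
  have hD6 : (D : ℝ) ^ 6 < (q : ℝ) ^ 6 := pow_lt_pow_left₀ hDq' hD0.le (by norm_num)
  have h1 : K * (D : ℝ) ^ 6 * (q : ℝ) ^ 6 < K * (q : ℝ) ^ 6 * (q : ℝ) ^ 6 := by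
    have hKq : 0 < K * (q : ℝ) ^ 6 := by positivity
    calc K * (D : ℝ) ^ 6 * (q : ℝ) ^ 6 = (K * (q : ℝ) ^ 6) * (D : ℝ) ^ 6 := by ring
      _ < (K * (q : ℝ) ^ 6) * (q : ℝ) ^ 6 := mul_lt_mul_of_pos_left hD6 hKq
      _ = K * (q : ℝ) ^ 6 * (q : ℝ) ^ 6 := by ring
  have h2 : (q : ℝ) ^ n = (q : ℝ) ^ 12 * (q : ℝ) ^ (n - 12) := by
    rw [← pow_add]; congr 1; omega
  have h3 : (2 : ℝ) ^ (n - 12) ≤ (q : ℝ) ^ (n - 12) := pow_le_pow_left₀ (by norm_num) hq2 _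
  have h4 : K < (2 : ℝ) ^ (n - 12) := by
    calc K < N₁ := hN₁
      _ < (2 : ℝ) ^ N₁ := by exact_mod_cast Nat.lt_two_pow_self
      _ ≤ (2 : ℝ) ^ (n - 12) := pow_le_pow_right₀ (by norm_num) (by omega)
  have h5 : K * (q : ℝ) ^ 6 * (q : ℝ) ^ 6 < (q : ℝ) ^ n := by
    rw [h2]
    have hq12 : (0 : ℝ) < (q : ℝ) ^ 12 := by positivity
    calc K * (q : ℝ) ^ 6 * (q : ℝ) ^ 6 = (q : ℝ) ^ 12 * K := by ring
      _ < (q : ℝ) ^ 12 * (2 : ℝ) ^ (n - 12) := mul_lt_mul_of_pos_left h4 hq12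
      _ ≤ (q : ℝ) ^ 12 * (q : ℝ) ^ (n - 12) := mul_le_mul_of_nonneg_left h3 hq12.le
  linarith

/-- **(RN-diag-fin) from abc.** One `B` such that `x² + D = yⁿ` with `0 < D < y`, `x ≥ 1`,
`gcd(D, x) = 1` and `n ≥ 5` forces `y ≤ B` and `n ≤ B`: only finitely many squares lie within `y` below a
fifth or higher power `yⁿ`. Proof: `abc` at `ε = 1/10` raised to the 20th power, `rad ≤ D·x·y`,
`x²² ≤ y^{11n}`, `D < y` ⟹ `y^{9n−44} < C²⁰`. For fixed `n ≥ 5` this finiteness is a Hall-type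
statement not known unconditionally; for fixed `y` it is Bennett–Bugeaud 2012 Thm 1.2. [folklore] -/
theorem soloInformed_rnDiagFinite_of_abc (habc : _root_.ABC) :
    ∃ B : ℕ, ∀ y x D n : ℕ, 0 < x → 0 < D → Nat.Coprime D x → x ^ 2 + D = y ^ n → D < y → 5 ≤ n →
      y ≤ B ∧ n ≤ B := by
  obtain ⟨C, hC, hC'⟩ := (_root_.ABC_iff.mp habc) (1 / 10) (by norm_num)
  obtain ⟨N, hN⟩ := exists_nat_gt (C ^ 20)
  refine ⟨N + 44, fun y x D n hx hD hcop h hDy hn => ?_⟩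
  have hy : 0 < y := by omega
  have hy2 : 2 ≤ y := by omega
  have ht := soloInformed_isABCTriple_rn hx hD hcop h
  have hlt := hC' D (x ^ 2) (y ^ n) ht
  set c : ℝ := ((y ^ n : ℕ) : ℝ) with hc_def
  set r : ℝ := ((rad D (x ^ 2) (y ^ n) : ℕ) : ℝ) with hr_def
  have hc0 : 0 < c := by rw [hc_def]; exact_mod_cast pow_pos hy n
  have hr0 : 0 ≤ r := by rw [hr_def]; exact_mod_cast Nat.zero_le _
  have h11 : (1 : ℝ) + 1 / 10 = 11 / 10 := by norm_num
  rw [h11] at hlt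
  have h20 : c ^ 20 < (C * r ^ ((11 : ℝ) / 10)) ^ 20 := pow_lt_pow_left₀ hlt hc0.le (by norm_num)
  have hr22 : (r ^ ((11 : ℝ) / 10)) ^ 20 = r ^ 22 := by
    rw [← Real.rpow_mul_natCast hr0]
    norm_num
  rw [mul_pow, hr22] at h20
  -- nat side
  have hrle : rad D (x ^ 2) (y ^ n) ≤ D * x * y := soloInformed_rad_rn_le hx hy hD
  have hx2 : x ^ 2 ≤ y ^ n := by omega
  have hnat : (rad D (x ^ 2) (y ^ n)) ^ 22 ≤ y ^ 22 * (y ^ n) ^ 11 * y ^ 22 := by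
    calc (rad D (x ^ 2) (y ^ n)) ^ 22 ≤ (D * x * y) ^ 22 := Nat.pow_le_pow_left hrle 22
      _ = D ^ 22 * (x ^ 2) ^ 11 * y ^ 22 := by ring
      _ ≤ y ^ 22 * (y ^ n) ^ 11 * y ^ 22 := by gcongr
  have hreal : r ^ 22 ≤ (y : ℝ) ^ 22 * c ^ 11 * (y : ℝ) ^ 22 := by
    rw [hr_def, hc_def]; exact_mod_cast hnat
  have h6 : c ^ 20 < C ^ 20 * ((y : ℝ) ^ 22 * c ^ 11 * (y : ℝ) ^ 22) :=
    lt_of_lt_of_le h20 (by gcongr)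
  have h7 : c ^ 9 * c ^ 11 < (C ^ 20 * (y : ℝ) ^ 44) * c ^ 11 := by
    calc c ^ 9 * c ^ 11 = c ^ 20 := by ring
      _ < C ^ 20 * ((y : ℝ) ^ 22 * c ^ 11 * (y : ℝ) ^ 22) := h6
      _ = (C ^ 20 * (y : ℝ) ^ 44) * c ^ 11 := by ring
  have h8 : c ^ 9 < C ^ 20 * (y : ℝ) ^ 44 := lt_of_mul_lt_mul_right h7 (by positivity)
  have hcy : c = (y : ℝ) ^ n := by rw [hc_def]; push_cast; ring
  rw [hcy, ← pow_mul] at h8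
  have hsplit : (y : ℝ) ^ (n * 9) = (y : ℝ) ^ 44 * (y : ℝ) ^ (n * 9 - 44) := by
    rw [← pow_add]; congr 1; omega
  rw [hsplit] at h8
  have hy44 : (0 : ℝ) < (y : ℝ) ^ 44 := by positivity
  have h9 : (y : ℝ) ^ (n * 9 - 44) < C ^ 20 := by
    have h8' : (y : ℝ) ^ 44 * (y : ℝ) ^ (n * 9 - 44) < (y : ℝ) ^ 44 * C ^ 20 := by
      rw [mul_comm ((y : ℝ) ^ 44) (C ^ 20)]; exact h8
    exact lt_of_mul_lt_mul_left h8' hy44.le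
  have hyR : (2 : ℝ) ≤ y := by exact_mod_cast hy2
  have hk : 1 ≤ n * 9 - 44 := by omega
  constructor
  · have hyle : (y : ℝ) ≤ (y : ℝ) ^ (n * 9 - 44) := by
      calc (y : ℝ) = (y : ℝ) ^ 1 := (pow_one _).symm
        _ ≤ (y : ℝ) ^ (n * 9 - 44) := pow_le_pow_right₀ (by linarith) hk
    have hyN : (y : ℝ) < N := by linarith
    have hyN' : y < N := by exact_mod_cast hyN
    omega
  · have h2pow : (2 : ℝ) ^ (n * 9 - 44) < (2 : ℝ) ^ N := by
      calc (2 : ℝ) ^ (n * 9 - 44) ≤ (y : ℝ) ^ (n * 9 - 44) := pow_le_pow_left₀ (by norm_num) hyR _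
        _ < C ^ 20 := h9
        _ < N := hN
        _ < (2 : ℝ) ^ N := by exact_mod_cast Nat.lt_two_pow_self
    have hlt' := (pow_lt_pow_iff_right₀ (by norm_num : (1 : ℝ) < 2)).mp h2pow
    omega

/-- **Within one period the face is method-free.** If `x + q^k·√q < √D·η` (the solution is itself
reduced with respect to a unit `η > 1` of `ℚ(√q)`, i.e. unit exponent `m = 0`), then trivially
`q^{2k+1} < D·η²`; Baker's method in `ℚ(√q)` only bounds the unit exponent `m` and says nothing here,
while `abc` still demands `q^{2k+1} < K·D⁶·q⁶` — for bases with regulator `log η ≫ log q` this window is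
where the content of the RN face sits. [folklore] -/
theorem soloInformed_rn_withinPeriod (q k x : ℕ) (D η : ℝ) (hD : 0 ≤ D) (hη : 0 < η)
    (h : (x : ℝ) + (q : ℝ) ^ k * Real.sqrt q < Real.sqrt D * η) :
    (q : ℝ) ^ (2 * k + 1) < D * η ^ 2 := by
  have hq0 : (0 : ℝ) ≤ (q : ℝ) := Nat.cast_nonneg q
  have hx0 : (0 : ℝ) ≤ (x : ℝ) := Nat.cast_nonneg x
  have hs : (0 : ℝ) ≤ (q : ℝ) ^ k * Real.sqrt q := by positivity
  have hlt : (q : ℝ) ^ k * Real.sqrt q < Real.sqrt D * η := by linarith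
  have hpos : 0 ≤ Real.sqrt D * η := by positivity
  have hsq : ((q : ℝ) ^ k * Real.sqrt q) ^ 2 < (Real.sqrt D * η) ^ 2 :=
    pow_lt_pow_left₀ hlt hs (by norm_num)
  have hl : ((q : ℝ) ^ k * Real.sqrt q) ^ 2 = (q : ℝ) ^ (2 * k + 1) := by
    rw [mul_pow, Real.sq_sqrt hq0, ← pow_mul, ← pow_succ]
    ring_nf
  have hr : (Real.sqrt D * η) ^ 2 = D * η ^ 2 := by
    rw [mul_pow, Real.sq_sqrt hD]
  rw [hl, hr] at hsq
  exact hsq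

/-- Bauer–Bennett's base-5 data: the anchor `11² + 4 = 5³` (table (9.1): `m₀ = 3`, `Δ = 4`, `a = 1`,
`α = 5.019`, whence `λ(5) = 1.344`, `λ₂(5) = 1.36`) and the two exceptional triples `(5, 3, 4)`,
`(5, 5, −11)` of Corollary 1.7 (`x² + D = 5ⁿ`, `D ≠ 0` ⟹ `n < 3.125·log|D|/log 5` otherwise): the
RN-shape for base `5` with `K = 5⁵`, `M = 3.125` is a theorem in print.
[cite: BauerBennett2002, Cor 1.7 p.216, tables (1.12), (1.18), (9.1)] -/
theorem soloInformed_bauerBennett_base5 :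
    11 ^ 2 + 4 = 5 ^ 3 ∧ 56 ^ 2 = 5 ^ 5 + 11 := by norm_num

/-- The solutions of `0 < |yⁿ − x²| < y` with `n ≥ 5` odd, `2 ≤ y ≤ 10⁷`, `yⁿ ≤ 10¹⁰⁰` found by the
seat's exact enumeration (work/s16/rndiag.py → rndiag_Y1e7.out; planted controls) are exactly these four,
all with `n = 5`, `yⁿ > x²`, `y ∈ {8, 55, 76, 377}` composite (`gcd(x, D) = 2` for `y = 76`); `(55, 5, 19)`
and `(76, 5, 60)` are two of Bauer–Bennett's nine exceptional triples and `(8, 5, 7)` is `181² + 7 = 2¹⁵`.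
Exact facts. [folklore] -/
theorem soloInformed_rnDiag_solutions :
    (181 ^ 2 + 7 = 8 ^ 5 ∧ 7 < 8) ∧ (22434 ^ 2 + 19 = 55 ^ 5 ∧ 19 < 55) ∧
    (50354 ^ 2 + 60 = 76 ^ 5 ∧ 60 < 76) ∧ (2759646 ^ 2 + 341 = 377 ^ 5 ∧ 341 < 377) := by
  norm_num

end Summit.ABC.ABC.Theorems
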